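import Literature.Analysis.FluidPDE.Ferrari1993MoserInequality
import HarnessLib

/-!
# Product estimates for the data of the pressure Neumann problem (Ferrari 1993, Lemma 2 via
Lemma 1 i))

Topic `Literature/Analysis/FluidPDE`. Support file (all results proved, no named facts, no
definitions). Second file of the decomposition of the named fact
`Literature.Analysis.FluidPDE.Ferrari1993_periodicCylinderPressureEstimate`
(`Ferrari1993EnergyInequalityReduction.lean`; A. B. Ferrari, Comm. Math. Phys. **155** (1993),
Lemma 2, pp. 280–281). In the printed proof the standard Neumann estimate
`|∇p|_{H^s} ≤ C(|Δp|_{H^{s−1}(Ω)} + |∂p/∂n|_{H^{s−1/2}(∂Ω)})` is fed with the data of the Neumann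
problem (10)–(12), `Δp = −Σᵢⱼ ∂ᵢuⱼ∂ⱼuᵢ`, `∂p/∂n = −Σ uᵢuⱼψᵢⱼ`, whose size is controlled by "the
first part of Lemma 1" (Lemma 1 i), p. 280: for `f, g ∈ H^s ∩ C(Ω̄)`,
`|fg|_{H^s} ≤ C(|f|_{H^s}|g|_{L^∞} + |f|_{L^∞}|g|_{H^s})`, the Moser product estimate) and the
chain rule: `|Σ∂ᵢuⱼ∂ⱼuᵢ|_{H^{s−1}} + Σ|uᵢuⱼψᵢⱼ|_{H^s} ≤ C |u|_{W^{1,∞}} |u|_{H^s}`. This file proves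
these two data estimates at `s = 3` on the open period cell `{r < 1} × (0, L)` of the periodic
cylinder, in the form consumed by the assembly (`Ferrari1993PressureEstimateReduction.lean`) —
where `Δp(t) = −tr(D_K u ∘ D_K u)` (`Ferrari1993PressureNeumannProblem.lean`,
`IsPeriodicCylinderEulerSolution.cylLap_pressure_eq`) is expanded in the basis
`(eᵢ) = Module.finBasis ℝ ℝ³` of the tree's Sobolev norm with coordinate functionals `ℓᵢ` as
`tr(T ∘ T) = Σᵢⱼ ℓⱼ(T eᵢ) ℓᵢ(T eⱼ)` (`trace_comp_self_eq_sum_coord`), and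
`∂p/∂n = u₀² + u₁²` on the wall (`neumann_pressure_eq`):

* `exists_eSobolevDomainNorm_two_coord_fderivWithin_mul_le` — for `L > 0` there is `C` with
  `‖ℓⱼ(∂ᵢu) ℓⱼ'(∂ᵢ'u)‖_{H²(cell)} ≤ C ‖u‖_{W^{1,∞}(cell)} ‖u‖_{H³(cell)}`
  for every velocity field `u` of class `C^∞` on the closed cylinder `{r ≤ 1}`, `L`-periodic in
  `z`, and all indices (`∂ᵢu = D u|_K (eᵢ)` realised up to the wall). Proof: Leibniz at orders
  `≤ 2` (`fderiv_smul_apply_of_isOpen`, `fderiv_fderiv_smul_apply_of_isOpen` of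
  `Ferrari1993MoserInequality.lean`), Hölder `L² × L^∞` / `L^∞ × L²` for the terms with at most one
  derivative on one factor, and for the middle terms `∂ₐ(ℓⱼ∂ᵢu) ∂_b(ℓⱼ'∂ᵢ'u)` Hölder `L⁴ × L⁴` with
  the **Nirenberg `L⁴` inequality on the cell** in Sobolev form
  (`exists_sq_eLpNorm_four_fderiv_le_cylinderCell`: `‖∂ₐh‖²_{L⁴} ≤ C ‖h‖_{L^∞} ‖h‖_{H²}` applied
  to `h = ∂ᵢu`, so that `‖∂ₐ∂ᵢu‖²_{L⁴} ≲ ‖u‖_{W^{1,∞}} ‖u‖_{H³}`). This is the `H^{s−1}` bound of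
  `Σ∂ᵢuⱼ∂ⱼuᵢ` with only `|u|_{W^{1,∞}}` (not `|Du|_{W^{1,∞}}`) on the right, which is the point of
  Ferrari's Lemma 2 over Temam's `|u|_s²`.
* `exists_eSobolevDomainNorm_three_coord_sq_le` —
  `‖u_k²‖_{H³(cell)} ≤ C ‖u‖_{W^{1,∞}(cell)} ‖u‖_{H³(cell)}` for the standard coordinates
  `u_k = ⟪u, e_k⟫`, `k < 3`: from Ferrari's Lemma 1 ii) **proved** in the tree
  (`Ferrari1993_periodicCylinderMoserInequality_holds`: `‖D_w(fg) − fD_wg‖_{L²} ≤ C(‖f‖_{H³}‖g‖_{L^∞} + ‖f‖_{W^{1,∞}}‖g‖_{H²})`)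
  with `f = u_k`, `g = u`, plus `‖u_k D_w u‖_{L²} ≤ ‖u_k‖_{L^∞} ‖D_w u‖_{L²}`, summed over the words
  of the norm, and `u_k² = ℓ(u_k u)` for the coordinate projection `ℓ = proj_k`.

All statements are folklore calculus / measure theory given the cited inequalities.

Mathlib/tree search: product / Moser estimates on the cell: `Ferrari1993MoserInequality.lean`
(imported; its Leibniz lemmas, Hölder bookkeeping `eLpNorm_fun_smul_le_*`, word bounds
`eLpNorm_iterDeriv_le_eSobolevDomainNorm_of_le`, `eLpNorm_fderiv*_basis_le_eSobolevDomainNorm`,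
`eSobolevDomainNorm_fderiv_basis_le_succ` and the `L⁴` lemma are reused); nothing for the specific
data (`lean search 'coord_fderivWithin_mul|coord_sq'`). From Mathlib: `LinearMap.trace_eq_matrix_trace`,
`LinearMap.toMatrix_apply`, `Module.Basis.sum_repr`, `Fintype.card_fun`, `finrank_euclideanSpace_fin`.

## References

* A. B. Ferrari, *On the blow-up of solutions of the 3-D Euler equations in a bounded domain*,
  Comm. Math. Phys. 155 (1993) 277–294, Lemma 1 i) p. 280 and the proof of Lemma 2, p. 281.
  [Ferrari1993]
* R. Temam, *On the Euler equations of incompressible perfect fluids*, J. Funct. Anal. 20 (1975)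
  32–43, §1 (1.2)–(1.3) (the same data with `|u|_s²`). [Temam1975]
-/

noncomputable section

open MeasureTheory Set Function Filter Topology TopologicalSpace WithLp
open scoped ContDiff NNReal ENNReal InnerProductSpace RealInnerProductSpace

namespace Literature.Analysis.FluidPDE

open Literature.Analysis.FunctionSpaces

/-! ### Linear algebra: the trace of `T ∘ T` in coordinates -/

section Trace

variable {E : Type*} [AddCommGroup E] [Module ℝ E] {ι : Type*} [Fintype ι] [DecidableEq ι]

/-- **`tr(T ∘ T) = Σᵢⱼ ℓⱼ(T eᵢ) ℓᵢ(T eⱼ)`** in any basis `(eᵢ)` with coordinate functionals `ℓᵢ`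
(the matrix of `T ∘ T` is the square of the matrix of `T`). For `T = Du` this is
`Σᵢⱼ ∂ᵢuⱼ ∂ⱼuᵢ`, the right-hand side of Ferrari's (10). [folklore] -/
theorem trace_comp_self_eq_sum_coord (b : Module.Basis ι ℝ E) (T : E →ₗ[ℝ] E) :
    LinearMap.trace ℝ E (T ∘ₗ T) = ∑ i, ∑ j, b.coord j (T (b i)) * b.coord i (T (b j)) := by
  rw [LinearMap.trace_eq_matrix_trace ℝ b, LinearMap.toMatrix_comp b b b, Matrix.trace]
  refine Finset.sum_congr rfl fun i _ => ?_
  rw [Matrix.diag_apply, Matrix.mul_apply]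
  refine Finset.sum_congr rfl fun j _ => ?_
  rw [LinearMap.toMatrix_apply, LinearMap.toMatrix_apply, Module.Basis.coord_apply,
    Module.Basis.coord_apply, mul_comm]

end Trace

/-! ### Two small measure-theoretic lemmas -/

section Small

variable {α : Type*} {m0 : MeasurableSpace α} {ν : Measure α}
variable {F G : Type*} [NormedAddCommGroup F] [NormedSpace ℝ F] [NormedAddCommGroup G]
  [NormedSpace ℝ G]

/-- `‖ℓ ∘ h‖_{L^p} ≤ ‖ℓ‖ ‖h‖_{L^p}` for a continuous linear map `ℓ`. [folklore] -/
theorem eLpNorm_clm_comp_fun_le (ℓ : F →L[ℝ] G) (h : α → F) (p : ℝ≥0∞) :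
    eLpNorm (fun x => ℓ (h x)) p ν ≤ ‖ℓ‖₊ * eLpNorm h p ν :=
  le_of_le_of_eq (eLpNorm_le_nnreal_smul_eLpNorm_of_ae_le_mul
    (Eventually.of_forall fun x => ℓ.le_opNNNorm (h x)) p) rfl

omit [NormedSpace ℝ G] in
/-- `‖A‖_{L²} ≤ ‖A − B‖_{L²} + ‖B‖_{L²}`. [folklore] -/
theorem eLpNorm_le_eLpNorm_sub_add {A B : α → G} (hA : AEStronglyMeasurable A ν)
    (hB : AEStronglyMeasurable B ν) :
    eLpNorm A 2 ν ≤ eLpNorm (fun x => A x - B x) 2 ν + eLpNorm B 2 ν := by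
  have h : A = fun x => (A x - B x) + B x := by funext x; abel
  calc eLpNorm A 2 ν = eLpNorm (fun x => (A x - B x) + B x) 2 ν := by rw [← h]
    _ ≤ eLpNorm (fun x => A x - B x) 2 ν + eLpNorm B 2 ν := eLpNorm_fun_add_le_two (hA.sub hB) hB

end Small

/-! ### Calculus: a continuous linear functional passes through derivatives -/

section CLM

variable {E : Type*} [NormedAddCommGroup E] [NormedSpace ℝ E]
variable {F G : Type*} [NormedAddCommGroup F] [NormedSpace ℝ F] [NormedAddCommGroup G]
  [NormedSpace ℝ G]

/-- `D(ℓ ∘ h)(x) e = ℓ (Dh(x) e)` at a point of differentiability. [folklore] -/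
theorem fderiv_clm_comp_apply' (ℓ : F →L[ℝ] G) {h : E → F} {x : E} (hd : DifferentiableAt ℝ h x)
    (e : E) : fderiv ℝ (fun y => ℓ (h y)) x e = ℓ (fderiv ℝ h x e) := by
  rw [show (fun y => ℓ (h y)) = ℓ ∘ h from rfl, (ℓ.hasFDerivAt.comp x hd.hasFDerivAt).fderiv]
  rfl

/-- On an open set of smoothness, `∂ₑ(ℓ ∘ h) = ℓ ∘ ∂ₑh`. [folklore] -/
theorem eqOn_fderiv_clm_comp_apply {U : Set E} (hU : IsOpen U) (ℓ : F →L[ℝ] G) {h : E → F}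
    (hh : ContDiffOn ℝ ∞ h U) (e : E) :
    EqOn (fun x => fderiv ℝ (fun y => ℓ (h y)) x e) (fun x => ℓ (fderiv ℝ h x e)) U :=
  fun _ hx => fderiv_clm_comp_apply' ℓ (differentiableAt_of_contDiffOn_isOpen hU hh hx) e

/-- On an open set of smoothness, `∂_c∂ₐ(ℓ ∘ h) = ℓ ∘ ∂_c∂ₐh`. [folklore] -/
theorem eqOn_fderiv_fderiv_clm_comp_apply {U : Set E} (hU : IsOpen U) (ℓ : F →L[ℝ] G) {h : E → F}
    (hh : ContDiffOn ℝ ∞ h U) (a c : E) :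
    EqOn (fun x => fderiv ℝ (fun y => fderiv ℝ (fun z => ℓ (h z)) y a) x c)
      (fun x => ℓ (fderiv ℝ (fun y => fderiv ℝ h y a) x c)) U := by
  intro x hx
  have hev : (fun y => fderiv ℝ (fun z => ℓ (h z)) y a) =ᶠ[𝓝 x] fun y => ℓ (fderiv ℝ h y a) :=
    eventuallyEq_of_mem (hU.mem_nhds hx) (eqOn_fderiv_clm_comp_apply hU ℓ hh a)
  show fderiv ℝ (fun y => fderiv ℝ (fun z => ℓ (h z)) y a) x c = ℓ (fderiv ℝ (fun y => fderiv ℝ h y a) x c)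
  rw [hev.fderiv_eq]
  exact fderiv_clm_comp_apply' ℓ
    (differentiableAt_of_contDiffOn_isOpen hU (contDiffOn_fderiv_apply_of_isOpen hU hh a) hx) c

end CLM

/-! ### The `H²` estimate of the products `∂ᵢuⱼ ∂ᵢ'uⱼ'` -/

/-- **The data of (10) in `H²(cell)`**: for `L > 0` there is `C` such that for every velocity
field `u` of class `C^∞` on the closed cylinder `{r ≤ 1}` and `L`-periodic in `z`, and all
indices `i, j, i', j'` of the basis `(eᵢ) = Module.finBasis ℝ ℝ³` (coordinate functionals `ℓⱼ`),
`‖ℓⱼ(∂ᵢu) · ℓⱼ'(∂ᵢ'u)‖_{H²(cell)} ≤ C ‖u‖_{W^{1,∞}(cell)} ‖u‖_{H³(cell)}`,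
where `∂ᵢu = Du|_{{r ≤ 1}}(eᵢ)` (the derivative within the closed cylinder) and the norms are the
tree's `eSobolevDomainNorm k p (cylinderCell L) volume`. This is Ferrari's bound
`|Σᵢⱼ ∂ᵢuⱼ∂ⱼuᵢ|_{H^{s−1}(Ω)} ≤ C|u|_{W^{1,∞}}|u|_{H^s}` (p. 281, "the first part of Lemma 1") at
`s = 3`, termwise: Leibniz at orders `≤ 2`, Hölder `L² × L^∞` / `L^∞ × L²`, and `L⁴ × L⁴` with
Nirenberg's inequality `‖∂ₐ∂ᵢu‖²_{L⁴(cell)} ≤ C‖∂ᵢu‖_{L^∞}‖∂ᵢu‖_{H²}` for the middle terms. [cite: Ferrari1993, Lemma 1 i) p. 280 and proof of Lemma 2 p. 281] -/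
theorem exists_eSobolevDomainNorm_two_coord_fderivWithin_mul_le {L : ℝ} (hL : 0 < L) :
    ∃ C : ℝ≥0, ∀ (u : (EuclideanSpace ℝ (Fin 3)) → (EuclideanSpace ℝ (Fin 3))),
      ContDiffOn ℝ ∞ u (closure (unitCylinder : Set (EuclideanSpace ℝ (Fin 3)))) →
      IsAxiallyPeriodic L u →
      ∀ i j i' j' : Fin (Module.finrank ℝ (EuclideanSpace ℝ (Fin 3))),
      eSobolevDomainNorm 2 2 (cylinderCell L) volume (fun x =>
          (Module.finBasis ℝ (EuclideanSpace ℝ (Fin 3))).coord j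
              (fderivWithin ℝ u (closure (unitCylinder : Set (EuclideanSpace ℝ (Fin 3)))) x
                (Module.finBasis ℝ (EuclideanSpace ℝ (Fin 3)) i)) *
            (Module.finBasis ℝ (EuclideanSpace ℝ (Fin 3))).coord j'
              (fderivWithin ℝ u (closure (unitCylinder : Set (EuclideanSpace ℝ (Fin 3)))) x
                (Module.finBasis ℝ (EuclideanSpace ℝ (Fin 3)) i'))) ≤
        C * eSobolevDomainNorm 1 ∞ (cylinderCell L) volume u *
          eSobolevDomainNorm 3 2 (cylinderCell L) volume u := by
  obtain ⟨Cg, hCg⟩ := exists_sq_eLpNorm_four_fderiv_le_cylinderCell (F := (EuclideanSpace ℝ (Fin 3))) hL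
  -- the basis, its dual functionals and the constants
  set ι := Fin (Module.finrank ℝ (EuclideanSpace ℝ (Fin 3))) with hι
  set b : Module.Basis ι ℝ (EuclideanSpace ℝ (Fin 3)) := Module.finBasis ℝ (EuclideanSpace ℝ (Fin 3))
    with hb
  set ℓ : ι → ((EuclideanSpace ℝ (Fin 3)) →L[ℝ] ℝ) := fun k => LinearMap.toContinuousLinearMap (b.coord k)
    with hℓ
  set Λ : ℝ≥0 := ∑ k, ‖ℓ k‖₊ with hΛ
  set C₁ : ℝ≥0 := max 1 Cg with hC₁
  refine ⟨52 * C₁ * Λ * Λ, fun u hu hper i j i' j' => ?_⟩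
  -- notation
  set K : Set (EuclideanSpace ℝ (Fin 3)) := closure (unitCylinder : Set (EuclideanSpace ℝ (Fin 3)))
    with hK_def
  set Ω : Set (EuclideanSpace ℝ (Fin 3)) := (cylinderCell L : Set (EuclideanSpace ℝ (Fin 3))) with hΩ_def
  set μ : Measure (EuclideanSpace ℝ (Fin 3)) := volume.restrict Ω with hμ
  have hKu : UniqueDiffOn ℝ K := uniqueDiffOn_closure_unitCylinder
  have hU : IsOpen (unitCylinder : Set (EuclideanSpace ℝ (Fin 3))) := unitCylinder.isOpen
  have hΩU : Ω ⊆ (unitCylinder : Set (EuclideanSpace ℝ (Fin 3))) := cylinderCell_le_unitCylinder L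
  have hΩm : MeasurableSet Ω := (cylinderCell L).isOpen.measurableSet
  have hnhds : ∀ x ∈ (unitCylinder : Set (EuclideanSpace ℝ (Fin 3))), K ∈ 𝓝 x := fun x hx =>
    closure_unitCylinder_mem_nhds hx
  have huU : ContDiffOn ℝ ∞ u (unitCylinder : Set (EuclideanSpace ℝ (Fin 3))) := hu.mono subset_closure
  have huΩ : ContDiffOn ℝ ∞ u (cylinderCell L) := huU.mono hΩU
  -- the derivative fields, classical and up to the boundary
  set H : ι → (EuclideanSpace ℝ (Fin 3)) → (EuclideanSpace ℝ (Fin 3)) := fun k x => fderiv ℝ u x (b k)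
    with hH
  set HK : ι → (EuclideanSpace ℝ (Fin 3)) → (EuclideanSpace ℝ (Fin 3)) := fun k x =>
    fderivWithin ℝ u K x (b k) with hHK
  have hHKs : ∀ k, ContDiffOn ℝ ∞ (HK k) K := fun k =>
    (hu.fderivWithin hKu (by simp)).clm_apply contDiffOn_const
  have hHKper : ∀ k, IsAxiallyPeriodic L (HK k) := fun k => isAxiallyPeriodic_fderivWithin_apply hper (b k)
  have hHU : ∀ k, EqOn (HK k) (H k) (unitCylinder : Set (EuclideanSpace ℝ (Fin 3))) := fun k x hx => by
    show fderivWithin ℝ u K x (b k) = fderiv ℝ u x (b k)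
    rw [fderivWithin_of_mem_nhds (hnhds x hx)]
  have sH : ∀ k, ContDiffOn ℝ ∞ (H k) (unitCylinder : Set (EuclideanSpace ℝ (Fin 3))) := fun k =>
    contDiffOn_fderiv_apply_of_isOpen hU huU (b k)
  have sH1 : ∀ k a, ContDiffOn ℝ ∞ (fun x => fderiv ℝ (H k) x (b a))
      (unitCylinder : Set (EuclideanSpace ℝ (Fin 3))) := fun k a =>
    contDiffOn_fderiv_apply_of_isOpen hU (sH k) (b a)
  have sH2 : ∀ k a c, ContDiffOn ℝ ∞ (fun x => fderiv ℝ (fun y => fderiv ℝ (H k) y (b a)) x (b c))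
      (unitCylinder : Set (EuclideanSpace ℝ (Fin 3))) := fun k a c =>
    contDiffOn_fderiv_apply_of_isOpen hU (sH1 k a) (b c)
  -- the two scalar factors (classical versions)
  set φ : (EuclideanSpace ℝ (Fin 3)) → ℝ := fun x => ℓ j (H i x) with hφ_def
  set ψ : (EuclideanSpace ℝ (Fin 3)) → ℝ := fun x => ℓ j' (H i' x) with hψ_def
  have hφ : ContDiffOn ℝ ∞ φ (unitCylinder : Set (EuclideanSpace ℝ (Fin 3))) :=
    (ℓ j).contDiff.comp_contDiffOn (sH i)
  have hψ : ContDiffOn ℝ ∞ ψ (unitCylinder : Set (EuclideanSpace ℝ (Fin 3))) :=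
    (ℓ j').contDiff.comp_contDiffOn (sH i')
  have hφ1 : ∀ a, ContDiffOn ℝ ∞ (fun x => fderiv ℝ φ x (b a)) (unitCylinder : Set (EuclideanSpace ℝ (Fin 3))) :=
    fun a => contDiffOn_fderiv_apply_of_isOpen hU hφ (b a)
  have hψ1 : ∀ a, ContDiffOn ℝ ∞ (fun x => fderiv ℝ ψ x (b a)) (unitCylinder : Set (EuclideanSpace ℝ (Fin 3))) :=
    fun a => contDiffOn_fderiv_apply_of_isOpen hU hψ (b a)
  have hφ2 : ∀ a c, ContDiffOn ℝ ∞ (fun x => fderiv ℝ (fun y => fderiv ℝ φ y (b a)) x (b c))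
      (unitCylinder : Set (EuclideanSpace ℝ (Fin 3))) := fun a c =>
    contDiffOn_fderiv_apply_of_isOpen hU (hφ1 a) (b c)
  have hψ2 : ∀ a c, ContDiffOn ℝ ∞ (fun x => fderiv ℝ (fun y => fderiv ℝ ψ y (b a)) x (b c))
      (unitCylinder : Set (EuclideanSpace ℝ (Fin 3))) := fun a c =>
    contDiffOn_fderiv_apply_of_isOpen hU (hψ1 a) (b c)
  -- the target function is `φ ψ` on the cell
  have hcongr : EqOn (fun x => b.coord j (HK i x) * b.coord j' (HK i' x)) (fun x => φ x • ψ x) Ω := by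
    intro x hx
    have hxU := hΩU hx
    simp only [hφ_def, hψ_def, smul_eq_mul, hℓ, LinearMap.coe_toContinuousLinearMap', hHU i hxU,
      hHU i' hxU]
  rw [SobolevApprox.eSobolevDomainNorm_congr hcongr]
  have hprod : ContDiffOn ℝ ∞ (fun x => φ x • ψ x) (cylinderCell L) := (hφ.smul hψ).mono hΩU
  rw [eSobolevDomainNorm_eq_sum_iterDeriv 2 2 hprod]
  -- measurability of products on the cell
  have meas : ∀ {f g : (EuclideanSpace ℝ (Fin 3)) → ℝ},
      ContinuousOn f (unitCylinder : Set (EuclideanSpace ℝ (Fin 3))) →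
      ContinuousOn g (unitCylinder : Set (EuclideanSpace ℝ (Fin 3))) →
      AEStronglyMeasurable (fun x => f x • g x) μ :=
    fun hf hg => aestronglyMeasurable_cylinderCell_of_continuousOn L (hf.smul hg)
  have meass : ∀ {f : (EuclideanSpace ℝ (Fin 3)) → ℝ},
      ContinuousOn f (unitCylinder : Set (EuclideanSpace ℝ (Fin 3))) → AEStronglyMeasurable f μ :=
    fun hf => aestronglyMeasurable_cylinderCell_of_continuousOn L hf
  -- the two sizes
  set S : ℝ≥0∞ := eSobolevDomainNorm 1 ∞ (cylinderCell L) volume u with hS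
  set N : ℝ≥0∞ := eSobolevDomainNorm 3 2 (cylinderCell L) volume u with hN
  -- bounds for the vector fields `H k` and their derivatives
  have hH_top : ∀ k, eLpNorm (H k) ∞ μ ≤ S := fun k =>
    eLpNorm_fderiv_basis_le_eSobolevDomainNorm ∞ le_rfl k huΩ
  have hH_2 : ∀ k, eLpNorm (H k) 2 μ ≤ N := fun k =>
    eLpNorm_fderiv_basis_le_eSobolevDomainNorm 2 (by norm_num) k huΩ
  have hH1_2 : ∀ k a, eLpNorm (fun x => fderiv ℝ (H k) x (b a)) 2 μ ≤ N := fun k a =>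
    eLpNorm_fderiv_fderiv_basis_le_eSobolevDomainNorm 2 (by norm_num) k a huΩ
  have hH2_2 : ∀ k a c, eLpNorm (fun x => fderiv ℝ (fun y => fderiv ℝ (H k) y (b a)) x (b c)) 2 μ ≤ N :=
    fun k a c => eLpNorm_fderiv_fderiv_fderiv_basis_le_eSobolevDomainNorm 2 le_rfl k a c huΩ
  have hH1_4 : ∀ k a, eLpNorm (fun x => fderiv ℝ (H k) x (b a)) 4 μ ^ 2 ≤ Cg * S * N := by
    intro k a
    have key := hCg (HK k) (hHKs k) (hHKper k) a
    have e1 : eLpNorm (fun x => fderiv ℝ (HK k) x (b a)) 4 μ = eLpNorm (fun x => fderiv ℝ (H k) x (b a)) 4 μ := by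
      refine eLpNorm_congr_ae (ae_restrict_of_forall_mem hΩm fun x hx => ?_)
      show fderiv ℝ (HK k) x (b a) = fderiv ℝ (H k) x (b a)
      rw [(eventuallyEq_of_mem (hU.mem_nhds (hΩU hx)) (hHU k)).fderiv_eq]
    have e2 : eLpNorm (HK k) ∞ μ ≤ S := by
      rw [eLpNorm_congr_ae (ae_restrict_of_forall_mem hΩm fun x hx => hHU k (hΩU hx))]
      exact hH_top k
    have e3 : eSobolevDomainNorm 2 2 (cylinderCell L) volume (HK k) ≤ N := by
      rw [SobolevApprox.eSobolevDomainNorm_congr (fun x hx => hHU k (hΩU hx))]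
      exact eSobolevDomainNorm_fderiv_basis_le_succ 2 2 k huΩ
    rw [e1] at key
    calc _ ≤ (Cg : ℝ≥0∞) * eLpNorm (HK k) ∞ μ * eSobolevDomainNorm 2 2 (cylinderCell L) volume (HK k) := key
      _ ≤ Cg * S * N := by gcongr
  -- the scalar factors: agreement of their derivatives with `ℓ ∘ ∂(H)`
  have eφ1 : ∀ a, EqOn (fun x => fderiv ℝ φ x (b a)) (fun x => ℓ j (fderiv ℝ (H i) x (b a)))
      (unitCylinder : Set (EuclideanSpace ℝ (Fin 3))) := fun a => eqOn_fderiv_clm_comp_apply hU (ℓ j) (sH i) (b a)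
  have eψ1 : ∀ a, EqOn (fun x => fderiv ℝ ψ x (b a)) (fun x => ℓ j' (fderiv ℝ (H i') x (b a)))
      (unitCylinder : Set (EuclideanSpace ℝ (Fin 3))) := fun a => eqOn_fderiv_clm_comp_apply hU (ℓ j') (sH i') (b a)
  have eφ2 : ∀ a c, EqOn (fun x => fderiv ℝ (fun y => fderiv ℝ φ y (b a)) x (b c))
      (fun x => ℓ j (fderiv ℝ (fun y => fderiv ℝ (H i) y (b a)) x (b c)))
      (unitCylinder : Set (EuclideanSpace ℝ (Fin 3))) := fun a c =>
    eqOn_fderiv_fderiv_clm_comp_apply hU (ℓ j) (sH i) (b a) (b c)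
  have eψ2 : ∀ a c, EqOn (fun x => fderiv ℝ (fun y => fderiv ℝ ψ y (b a)) x (b c))
      (fun x => ℓ j' (fderiv ℝ (fun y => fderiv ℝ (H i') y (b a)) x (b c)))
      (unitCylinder : Set (EuclideanSpace ℝ (Fin 3))) := fun a c =>
    eqOn_fderiv_fderiv_clm_comp_apply hU (ℓ j') (sH i') (b a) (b c)
  -- `‖ℓ k‖ ≤ Λ`
  have hℓΛ : ∀ k, (‖ℓ k‖₊ : ℝ≥0∞) ≤ Λ := fun k => by
    have : ‖ℓ k‖₊ ≤ Λ := Finset.single_le_sum (f := fun k => ‖ℓ k‖₊) (fun _ _ => zero_le) (Finset.mem_univ k)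
    exact_mod_cast this
  -- generic one-factor bounds: `‖ℓ ∘ X‖_{L^p} ≤ Λ ‖X‖_{L^p}` on the cell for fields agreeing on `U`
  have bnd : ∀ (k : ι) {X Y : (EuclideanSpace ℝ (Fin 3)) → ℝ} {V : (EuclideanSpace ℝ (Fin 3)) → (EuclideanSpace ℝ (Fin 3))}
      (p : ℝ≥0∞) {B : ℝ≥0∞},
      EqOn X (fun x => ℓ k (V x)) (unitCylinder : Set (EuclideanSpace ℝ (Fin 3))) →
      EqOn Y X (unitCylinder : Set (EuclideanSpace ℝ (Fin 3))) →
      eLpNorm V p μ ≤ B → eLpNorm Y p μ ≤ Λ * B := by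
    intro k X Y V p B hX hY hV
    calc eLpNorm Y p μ = eLpNorm (fun x => ℓ k (V x)) p μ :=
          eLpNorm_congr_ae (ae_restrict_of_forall_mem hΩm fun x hx => (hY (hΩU hx)).trans (hX (hΩU hx)))
      _ ≤ ‖ℓ k‖₊ * eLpNorm V p μ := eLpNorm_clm_comp_fun_le (ℓ k) V p
      _ ≤ Λ * B := mul_le_mul' (hℓΛ k) hV
  -- the sizes of the factors
  have sφ_top : eLpNorm φ ∞ μ ≤ Λ * S := bnd j ∞ (fun _ _ => rfl) (fun _ _ => rfl) (hH_top i)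
  have sφ_2 : eLpNorm φ 2 μ ≤ Λ * N := bnd j 2 (fun _ _ => rfl) (fun _ _ => rfl) (hH_2 i)
  have sψ_top : eLpNorm ψ ∞ μ ≤ Λ * S := bnd j' ∞ (fun _ _ => rfl) (fun _ _ => rfl) (hH_top i')
  have sψ_2 : eLpNorm ψ 2 μ ≤ Λ * N := bnd j' 2 (fun _ _ => rfl) (fun _ _ => rfl) (hH_2 i')
  have sφ1_2 : ∀ a, eLpNorm (fun x => fderiv ℝ φ x (b a)) 2 μ ≤ Λ * N := fun a =>
    bnd j 2 (eφ1 a) (fun _ _ => rfl) (hH1_2 i a)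
  have sψ1_2 : ∀ a, eLpNorm (fun x => fderiv ℝ ψ x (b a)) 2 μ ≤ Λ * N := fun a =>
    bnd j' 2 (eψ1 a) (fun _ _ => rfl) (hH1_2 i' a)
  have sφ2_2 : ∀ a c, eLpNorm (fun x => fderiv ℝ (fun y => fderiv ℝ φ y (b a)) x (b c)) 2 μ ≤ Λ * N :=
    fun a c => bnd j 2 (eφ2 a c) (fun _ _ => rfl) (hH2_2 i a c)
  have sψ2_2 : ∀ a c, eLpNorm (fun x => fderiv ℝ (fun y => fderiv ℝ ψ y (b a)) x (b c)) 2 μ ≤ Λ * N :=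
    fun a c => bnd j' 2 (eψ2 a c) (fun _ _ => rfl) (hH2_2 i' a c)
  have sφ1_4 : ∀ a, eLpNorm (fun x => fderiv ℝ φ x (b a)) 4 μ ^ 2 ≤ Λ ^ 2 * (Cg * S * N) := by
    intro a
    have h1 : eLpNorm (fun x => fderiv ℝ φ x (b a)) 4 μ ≤ Λ * eLpNorm (fun x => fderiv ℝ (H i) x (b a)) 4 μ :=
      bnd j 4 (eφ1 a) (fun _ _ => rfl) le_rfl
    calc _ ≤ (Λ * eLpNorm (fun x => fderiv ℝ (H i) x (b a)) 4 μ) ^ 2 := by gcongr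
      _ = Λ ^ 2 * eLpNorm (fun x => fderiv ℝ (H i) x (b a)) 4 μ ^ 2 := by ring
      _ ≤ Λ ^ 2 * (Cg * S * N) := by gcongr; exact hH1_4 i a
  have sψ1_4 : ∀ a, eLpNorm (fun x => fderiv ℝ ψ x (b a)) 4 μ ^ 2 ≤ Λ ^ 2 * (Cg * S * N) := by
    intro a
    have h1 : eLpNorm (fun x => fderiv ℝ ψ x (b a)) 4 μ ≤ Λ * eLpNorm (fun x => fderiv ℝ (H i') x (b a)) 4 μ :=
      bnd j' 4 (eψ1 a) (fun _ _ => rfl) le_rfl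
    calc _ ≤ (Λ * eLpNorm (fun x => fderiv ℝ (H i') x (b a)) 4 μ) ^ 2 := by gcongr
      _ = Λ ^ 2 * eLpNorm (fun x => fderiv ℝ (H i') x (b a)) 4 μ ^ 2 := by ring
      _ ≤ Λ ^ 2 * (Cg * S * N) := by gcongr; exact hH1_4 i' a
  -- the bound of one term
  set B : ℝ≥0∞ := C₁ * (Λ * Λ) * (S * N) with hB
  have hC₁1 : (1 : ℝ≥0∞) ≤ C₁ := by
    have : (1 : ℝ≥0) ≤ C₁ := le_max_left _ _
    exact_mod_cast this
  have hC₁2 : (Cg : ℝ≥0∞) ≤ C₁ := by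
    have : Cg ≤ C₁ := le_max_right _ _
    exact_mod_cast this
  have hΛΛ : (Λ : ℝ≥0∞) * N * (Λ * S) ≤ B := by
    calc (Λ : ℝ≥0∞) * N * (Λ * S) = 1 * (Λ * Λ) * (S * N) := by ring
      _ ≤ C₁ * (Λ * Λ) * (S * N) := by gcongr
  have hΛΛ' : (Λ : ℝ≥0∞) * S * (Λ * N) ≤ B := by
    calc (Λ : ℝ≥0∞) * S * (Λ * N) = Λ * N * (Λ * S) := by ring
      _ ≤ B := hΛΛ
  -- type A: `L²` factor times `L^∞` factor
  have typeA : ∀ {X : (EuclideanSpace ℝ (Fin 3)) → ℝ},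
      ContinuousOn X (unitCylinder : Set (EuclideanSpace ℝ (Fin 3))) → eLpNorm X 2 μ ≤ Λ * N →
      eLpNorm (fun x => X x • ψ x) 2 μ ≤ B := by
    intro X hXc hX
    calc eLpNorm (fun x => X x • ψ x) 2 μ ≤ eLpNorm X 2 μ * eLpNorm ψ ∞ μ :=
          eLpNorm_fun_smul_le_two_top (meass hXc)
      _ ≤ Λ * N * (Λ * S) := mul_le_mul' hX sψ_top
      _ ≤ B := hΛΛ
  -- type B: `L^∞` factor times `L²` factor
  have typeB : ∀ {Y : (EuclideanSpace ℝ (Fin 3)) → ℝ},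
      ContinuousOn Y (unitCylinder : Set (EuclideanSpace ℝ (Fin 3))) → eLpNorm Y 2 μ ≤ Λ * N →
      eLpNorm (fun x => φ x • Y x) 2 μ ≤ B := by
    intro Y hYc hY
    calc eLpNorm (fun x => φ x • Y x) 2 μ ≤ eLpNorm φ ∞ μ * eLpNorm Y 2 μ :=
          eLpNorm_fun_smul_le_top_two (meass hYc)
      _ ≤ Λ * S * (Λ * N) := mul_le_mul' sφ_top hY
      _ ≤ B := hΛΛ'
  -- type M: `L⁴ × L⁴`
  have typeM : ∀ a c, eLpNorm (fun x => fderiv ℝ φ x (b a) • fderiv ℝ ψ x (b c)) 2 μ ≤ B := by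
    intro a c
    have h1 : eLpNorm (fun x => fderiv ℝ φ x (b a) • fderiv ℝ ψ x (b c)) 2 μ ≤
        eLpNorm (fun x => fderiv ℝ φ x (b a)) 4 μ * eLpNorm (fun x => fderiv ℝ ψ x (b c)) 4 μ :=
      eLpNorm_fun_smul_le_four_four (meass (hφ1 a).continuousOn) (meass (hψ1 c).continuousOn)
    have h2 : (eLpNorm (fun x => fderiv ℝ φ x (b a)) 4 μ * eLpNorm (fun x => fderiv ℝ ψ x (b c)) 4 μ) ^ 2 ≤
        (Λ ^ 2 * (Cg * S * N)) * (Λ ^ 2 * (Cg * S * N)) := by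
      rw [mul_pow]
      exact mul_le_mul' (sφ1_4 a) (sψ1_4 c)
    have h3 : (Λ : ℝ≥0∞) ^ 2 * (Cg * S * N) ≤ B := by
      calc (Λ : ℝ≥0∞) ^ 2 * (Cg * S * N) = Cg * (Λ * Λ) * (S * N) := by ring
        _ ≤ C₁ * (Λ * Λ) * (S * N) := by gcongr
    have h4 : (eLpNorm (fun x => fderiv ℝ φ x (b a)) 4 μ * eLpNorm (fun x => fderiv ℝ ψ x (b c)) 4 μ) ^ 2 ≤
        B ^ 2 := by
      rw [sq B]
      exact h2.trans (mul_le_mul' h3 h3)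
    exact h1.trans ((ENNReal.pow_le_pow_left_iff two_ne_zero).1 h4)
  -- the bound for every word of length `≤ 2`
  have hword : ∀ (m : ℕ), m < 3 → ∀ w : Fin m → ι,
      eLpNorm (iterDeriv m (fun k => b (w k)) (fun x => φ x • ψ x)) 2 μ ≤ 4 * B := by
    intro m hm
    have h4B : ∀ {X : ℝ≥0∞} (n : ℕ), n ≤ 4 → X ≤ n * B → X ≤ 4 * B := by
      intro X n hn hX
      refine hX.trans ?_
      gcongr
      exact_mod_cast hn
    obtain rfl | rfl | rfl : m = 0 ∨ m = 1 ∨ m = 2 := by omega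
    · intro w
      rw [iterDeriv_zero]
      refine h4B 1 (by norm_num) ?_
      rw [Nat.cast_one, one_mul]
      exact typeA hφ.continuousOn sφ_2
    · intro w
      have hid : iterDeriv 1 (fun k => b (w k)) (fun x => φ x • ψ x) =ᵐ[μ]
          fun x => fderiv ℝ φ x (b (w 0)) • ψ x + φ x • fderiv ℝ ψ x (b (w 0)) := by
        rw [iterDeriv_one_eq]
        exact ae_restrict_of_forall_mem hΩm fun x hx =>
          fderiv_smul_apply_of_isOpen hU hφ hψ (b (w 0)) (hΩU hx)
      rw [eLpNorm_congr_ae hid]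
      refine h4B 2 (by norm_num) ?_
      have m1 := meas (hφ1 (w 0)).continuousOn hψ.continuousOn
      have m2 := meas hφ.continuousOn (hψ1 (w 0)).continuousOn
      calc _ ≤ _ := eLpNorm_fun_add_le_two m1 m2
        _ ≤ B + B := add_le_add (typeA (hφ1 (w 0)).continuousOn (sφ1_2 (w 0)))
            (typeB (hψ1 (w 0)).continuousOn (sψ1_2 (w 0)))
        _ = (2 : ℕ) * B := by push_cast; ring
    · intro w
      have hid : iterDeriv 2 (fun k => b (w k)) (fun x => φ x • ψ x) =ᵐ[μ]
          fun x => fderiv ℝ (fun y => fderiv ℝ φ y (b (w 0))) x (b (w 1)) • ψ x +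
            fderiv ℝ φ x (b (w 0)) • fderiv ℝ ψ x (b (w 1)) +
            fderiv ℝ φ x (b (w 1)) • fderiv ℝ ψ x (b (w 0)) +
            φ x • fderiv ℝ (fun y => fderiv ℝ ψ y (b (w 0))) x (b (w 1)) := by
        rw [iterDeriv_two_eq]
        exact ae_restrict_of_forall_mem hΩm fun x hx =>
          fderiv_fderiv_smul_apply_of_isOpen hU hφ hψ (b (w 0)) (b (w 1)) (hΩU hx)
      rw [eLpNorm_congr_ae hid]
      refine h4B 4 le_rfl ?_
      have m1 := meas (hφ2 (w 0) (w 1)).continuousOn hψ.continuousOn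
      have m2 := meas (hφ1 (w 0)).continuousOn (hψ1 (w 1)).continuousOn
      have m3 := meas (hφ1 (w 1)).continuousOn (hψ1 (w 0)).continuousOn
      have m4 := meas hφ.continuousOn (hψ2 (w 0) (w 1)).continuousOn
      have b1 := typeA (hφ2 (w 0) (w 1)).continuousOn (sφ2_2 (w 0) (w 1))
      have b2 := typeM (w 0) (w 1)
      have b3 := typeM (w 1) (w 0)
      have b4 := typeB (hψ2 (w 0) (w 1)).continuousOn (sψ2_2 (w 0) (w 1))
      calc _ ≤ _ := eLpNorm_fun_add_le_two ((m1.add m2).add m3) m4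
        _ ≤ _ := add_le_add (eLpNorm_fun_add_le_two (m1.add m2) m3) le_rfl
        _ ≤ _ := add_le_add (add_le_add (eLpNorm_fun_add_le_two m1 m2) le_rfl) le_rfl
        _ ≤ B + B + B + B := add_le_add (add_le_add (add_le_add b1 b2) b3) b4
        _ = (4 : ℕ) * B := by push_cast; ring
  -- sum over the words of length `≤ 2`: there are `1 + 3 + 9 = 13` of them
  have hcard : ∀ m : ℕ, (Finset.univ : Finset (Fin m → ι)).card = 3 ^ m := fun m => by
    simp only [Finset.card_univ, Fintype.card_fun, Fintype.card_fin, hι, finrank_euclideanSpace_fin]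
  calc ∑ m ∈ Finset.range (2 + 1), ∑ w : Fin m → ι,
        eLpNorm (iterDeriv m (fun k => b (w k)) (fun x => φ x • ψ x)) 2 μ
      ≤ ∑ m ∈ Finset.range (2 + 1), ∑ _w : Fin m → ι, 4 * B :=
        Finset.sum_le_sum fun m hm => Finset.sum_le_sum fun w _ => hword m (Finset.mem_range.1 hm) w
    _ = ∑ m ∈ Finset.range (2 + 1), (3 ^ m : ℕ) * (4 * B) := by
        refine Finset.sum_congr rfl fun m _ => ?_
        rw [Finset.sum_const, hcard m, nsmul_eq_mul]
    _ = 52 * B := by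
        simp only [Finset.sum_range_succ, Finset.sum_range_zero]
        push_cast
        ring
    _ = ((52 * C₁ * Λ * Λ : ℝ≥0) : ℝ≥0∞) * S * N := by
        rw [hB]
        push_cast
        ring

/-! ### The `H³` estimate of `u_k²` -/

/-- **The data of (12) in `H³(cell)`**: for `L > 0` there is `C` such that for every velocity field
`u` of class `C^∞` on the closed cylinder `{r ≤ 1}` and `L`-periodic in `z`, and every standard
coordinate `k < 3`,
`‖u_k²‖_{H³(cell)} ≤ C ‖u‖_{W^{1,∞}(cell)} ‖u‖_{H³(cell)}`
(`u_k(x) = (u x) k`; norms `eSobolevDomainNorm k p (cylinderCell L) volume`). This is Ferrari's bound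
of the boundary datum, `Σ|uᵢuⱼψᵢⱼ|_{H^{s−1/2}(∂Ω)} ≤ C Σ|uᵢuⱼΨᵢⱼ|_{H^s(Ω)} ≤ C|u|_{W^{1,∞}}|u|_{H^s}`
(p. 281 with Lemma 1 i)), for the cylinder (`∂p/∂n = u₀² + u₁²`) at `s = 3`; proved from Ferrari's
Lemma 1 ii) in the tree (`Ferrari1993_periodicCylinderMoserInequality_holds`) with `f = u_k`, `g = u`:
`‖D_w(u_k u)‖_{L²} ≤ ‖D_w(u_k u) − u_k D_w u‖_{L²} + ‖u_k‖_{L^∞}‖D_w u‖_{L²}`, summed over the words of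
the norm, and `u_k² = proj_k (u_k u)`. [cite: Ferrari1993, Lemma 1 i)–ii) p. 280 and proof of Lemma 2 p. 281] -/
theorem exists_eSobolevDomainNorm_three_coord_sq_le {L : ℝ} (hL : 0 < L) :
    ∃ C : ℝ≥0, ∀ (u : (EuclideanSpace ℝ (Fin 3)) → (EuclideanSpace ℝ (Fin 3))),
      ContDiffOn ℝ ∞ u (closure (unitCylinder : Set (EuclideanSpace ℝ (Fin 3)))) →
      IsAxiallyPeriodic L u → ∀ k : Fin 3,
      eSobolevDomainNorm 3 2 (cylinderCell L) volume (fun x => u x k ^ 2) ≤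
        C * eSobolevDomainNorm 1 ∞ (cylinderCell L) volume u *
          eSobolevDomainNorm 3 2 (cylinderCell L) volume u := by
  obtain ⟨CM, hCM⟩ := Ferrari1993_periodicCylinderMoserInequality_holds L hL
  set P : ℝ≥0 := ∑ k : Fin 3, ‖(EuclideanSpace.proj (𝕜 := ℝ) k : EuclideanSpace ℝ (Fin 3) →L[ℝ] ℝ)‖₊
    with hP
  refine ⟨40 * (2 * CM + 1) * P * P, fun u hu hper k => ?_⟩
  -- notation
  set ι := Fin (Module.finrank ℝ (EuclideanSpace ℝ (Fin 3))) with hι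
  set b : Module.Basis ι ℝ (EuclideanSpace ℝ (Fin 3)) := Module.finBasis ℝ (EuclideanSpace ℝ (Fin 3))
    with hb
  set K : Set (EuclideanSpace ℝ (Fin 3)) := closure (unitCylinder : Set (EuclideanSpace ℝ (Fin 3)))
    with hK_def
  set Ω : Set (EuclideanSpace ℝ (Fin 3)) := (cylinderCell L : Set (EuclideanSpace ℝ (Fin 3))) with hΩ_def
  set μ : Measure (EuclideanSpace ℝ (Fin 3)) := volume.restrict Ω with hμ
  have hU : IsOpen (unitCylinder : Set (EuclideanSpace ℝ (Fin 3))) := unitCylinder.isOpen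
  have hΩU : Ω ⊆ (unitCylinder : Set (EuclideanSpace ℝ (Fin 3))) := cylinderCell_le_unitCylinder L
  have hΩm : MeasurableSet Ω := (cylinderCell L).isOpen.measurableSet
  have huU : ContDiffOn ℝ ∞ u (unitCylinder : Set (EuclideanSpace ℝ (Fin 3))) := hu.mono subset_closure
  have huΩ : ContDiffOn ℝ ∞ u (cylinderCell L) := huU.mono hΩU
  -- the coordinate function `f = u_k` and the projection
  set π : (EuclideanSpace ℝ (Fin 3)) →L[ℝ] ℝ := EuclideanSpace.proj (𝕜 := ℝ) k with hπ
  set f : (EuclideanSpace ℝ (Fin 3)) → ℝ := fun x => π (u x) with hf_def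
  have hfK : ContDiffOn ℝ ∞ f K := π.contDiff.comp_contDiffOn hu
  have hfU : ContDiffOn ℝ ∞ f (unitCylinder : Set (EuclideanSpace ℝ (Fin 3))) := hfK.mono subset_closure
  have hfΩ : ContDiffOn ℝ ∞ f (cylinderCell L) := hfU.mono hΩU
  have hfper : IsAxiallyPeriodic L f := fun x => by simp only [hf_def, hper x]
  have hπP : (‖π‖₊ : ℝ≥0∞) ≤ P := by
    have : ‖π‖₊ ≤ P := Finset.single_le_sum
      (f := fun k : Fin 3 => ‖(EuclideanSpace.proj (𝕜 := ℝ) k : EuclideanSpace ℝ (Fin 3) →L[ℝ] ℝ)‖₊)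
      (fun _ _ => zero_le) (Finset.mem_univ k)
    exact_mod_cast this
  -- `u_k² = π (f • u)`
  have hsq : EqOn (fun x => u x k ^ 2) (fun x => π (f x • u x)) Ω := fun x _ => by
    simp only [hf_def, hπ, map_smul, smul_eq_mul, sq]
    rfl
  rw [SobolevApprox.eSobolevDomainNorm_congr hsq]
  have hprod : ContDiffOn ℝ ∞ (fun x => f x • u x) (cylinderCell L) := (hfU.smul huU).mono hΩU
  -- the sizes
  set S : ℝ≥0∞ := eSobolevDomainNorm 1 ∞ (cylinderCell L) volume u with hS
  set N : ℝ≥0∞ := eSobolevDomainNorm 3 2 (cylinderCell L) volume u with hN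
  have hf3 : eSobolevDomainNorm 3 2 (cylinderCell L) volume f ≤ ‖π‖₊ * N := eSobolevDomainNorm_clm_comp_le π 3 huΩ
  have hf1 : eSobolevDomainNorm 1 ∞ (cylinderCell L) volume f ≤ ‖π‖₊ * S := eSobolevDomainNorm_clm_comp_le π 1 huΩ
  have hf0 : eLpNorm f ∞ μ ≤ ‖π‖₊ * S := by
    calc eLpNorm f ∞ μ ≤ ‖π‖₊ * eLpNorm u ∞ μ := eLpNorm_clm_comp_fun_le π u ∞
      _ ≤ ‖π‖₊ * S := mul_le_mul' le_rfl eLpNorm_le_eSobolevDomainNorm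
  have hu0 : eSobolevDomainNorm 0 ∞ (cylinderCell L) volume u ≤ S := eSobolevDomainNorm_le_succ
  have hu2 : eSobolevDomainNorm 2 2 (cylinderCell L) volume u ≤ N := eSobolevDomainNorm_le_succ
  -- one word
  have hword : ∀ (m : ℕ), m ≤ 3 → ∀ w : Fin m → ι,
      eLpNorm (iterDeriv m (fun j => b (w j)) (fun x => f x • u x)) 2 μ ≤ ((2 * CM + 1) * P : ℝ≥0) * S * N := by
    intro m hm w
    have hM := hCM f u hfK hu hfper hper m hm w
    rw [show sobolevDir w = fun j => b (w j) from rfl] at hM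
    have cA : ContinuousOn (iterDeriv m (fun j => b (w j)) (fun x => f x • u x))
        (unitCylinder : Set (EuclideanSpace ℝ (Fin 3))) :=
      (ContDiffOn.iterDeriv_of_isOpen hU m _ (hfU.smul huU)).continuousOn
    have cD : ContinuousOn (iterDeriv m (fun j => b (w j)) u) (unitCylinder : Set (EuclideanSpace ℝ (Fin 3))) :=
      (ContDiffOn.iterDeriv_of_isOpen hU m _ huU).continuousOn
    have cB : ContinuousOn (fun x => f x • iterDeriv m (fun j => b (w j)) u x)
        (unitCylinder : Set (EuclideanSpace ℝ (Fin 3))) := hfU.continuousOn.smul cD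
    have mA := aestronglyMeasurable_cylinderCell_of_continuousOn L cA
    have mB := aestronglyMeasurable_cylinderCell_of_continuousOn L cB
    have mD := aestronglyMeasurable_cylinderCell_of_continuousOn L cD
    have h2 : eLpNorm (fun x => f x • iterDeriv m (fun j => b (w j)) u x) 2 μ ≤ ‖π‖₊ * S * N := by
      calc _ ≤ eLpNorm f ∞ μ * eLpNorm (iterDeriv m (fun j => b (w j)) u) 2 μ :=
            eLpNorm_fun_smul_le_top_two mD
        _ ≤ ‖π‖₊ * S * N := mul_le_mul' hf0 (eLpNorm_iterDeriv_le_eSobolevDomainNorm_of_le 2 hm w huΩ)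
    have h1 : eLpNorm (fun x => iterDeriv m (fun j => b (w j)) (fun y => f y • u y) x -
          f x • iterDeriv m (fun j => b (w j)) u x) 2 μ ≤ 2 * CM * ‖π‖₊ * S * N := by
      refine hM.trans ?_
      calc (CM : ℝ≥0∞) * (eSobolevDomainNorm 3 2 (cylinderCell L) volume f *
              eSobolevDomainNorm 0 ∞ (cylinderCell L) volume u +
            eSobolevDomainNorm 1 ∞ (cylinderCell L) volume f *
              eSobolevDomainNorm 2 2 (cylinderCell L) volume u)
          ≤ CM * ((‖π‖₊ * N) * S + (‖π‖₊ * S) * N) := by gcongr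
        _ = 2 * CM * ‖π‖₊ * S * N := by ring
    calc eLpNorm (iterDeriv m (fun j => b (w j)) (fun x => f x • u x)) 2 μ
        ≤ eLpNorm (fun x => iterDeriv m (fun j => b (w j)) (fun y => f y • u y) x -
            f x • iterDeriv m (fun j => b (w j)) u x) 2 μ +
          eLpNorm (fun x => f x • iterDeriv m (fun j => b (w j)) u x) 2 μ := eLpNorm_le_eLpNorm_sub_add mA mB
      _ ≤ 2 * CM * ‖π‖₊ * S * N + ‖π‖₊ * S * N := add_le_add h1 h2
      _ = (2 * CM + 1) * ‖π‖₊ * S * N := by ring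
      _ ≤ (2 * CM + 1) * P * S * N := by gcongr
      _ = ((2 * CM + 1) * P : ℝ≥0) * S * N := by push_cast; ring
  -- all words
  have hcard : ∀ m : ℕ, (Finset.univ : Finset (Fin m → ι)).card = 3 ^ m := fun m => by
    simp only [Finset.card_univ, Fintype.card_fun, Fintype.card_fin, hι, finrank_euclideanSpace_fin]
  have hfu : eSobolevDomainNorm 3 2 (cylinderCell L) volume (fun x => f x • u x) ≤
      (40 * ((2 * CM + 1) * P) : ℝ≥0) * S * N := by
    rw [eSobolevDomainNorm_eq_sum_iterDeriv 2 3 hprod]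
    calc ∑ m ∈ Finset.range (3 + 1), ∑ w : Fin m → ι,
          eLpNorm (iterDeriv m (fun j => b (w j)) (fun x => f x • u x)) 2 μ
        ≤ ∑ m ∈ Finset.range (3 + 1), ∑ _w : Fin m → ι, ((2 * CM + 1) * P : ℝ≥0) * S * N :=
          Finset.sum_le_sum fun m hm => Finset.sum_le_sum fun w _ =>
            hword m (Nat.lt_succ_iff.1 (Finset.mem_range.1 hm)) w
      _ = ∑ m ∈ Finset.range (3 + 1), (3 ^ m : ℕ) * (((2 * CM + 1) * P : ℝ≥0) * S * N) := by
          refine Finset.sum_congr rfl fun m _ => ?_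
          rw [Finset.sum_const, hcard m, nsmul_eq_mul]
      _ = (40 * ((2 * CM + 1) * P) : ℝ≥0) * S * N := by
          simp only [Finset.sum_range_succ, Finset.sum_range_zero]
          push_cast
          ring
  -- through the projection
  calc eSobolevDomainNorm 3 2 (cylinderCell L) volume (fun x => π (f x • u x))
      ≤ ‖π‖₊ * eSobolevDomainNorm 3 2 (cylinderCell L) volume (fun x => f x • u x) :=
        eSobolevDomainNorm_clm_comp_le π 3 hprod
    _ ≤ P * ((40 * ((2 * CM + 1) * P) : ℝ≥0) * S * N) := mul_le_mul' hπP hfu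
    _ = ((40 * (2 * CM + 1) * P * P : ℝ≥0) : ℝ≥0∞) * S * N := by push_cast; ring

end Literature.Analysis.FluidPDE
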